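import Literature.Analysis.FunctionSpaces.TorusHeatSmoothing
import Literature.Analysis.FunctionSpaces.TorusPeriodicLocalization
import HarnessLib

/-!
# K2R `RealisedQuasiStaticCellLaw`, line `floquet-bloch`: the diagonal hypotheses of the ladder functional for a principal
# coset `k₀ + ℤK` with `|k₀| ≤ |K|/4` (helper towards `stub_lowSectorDecay` / `stub_upperSome`; `--supports stmt-AnomalousDissipation-20446`)

Summits-side helper file (everything proved; no definitions, no named facts). The normalised diagonal
`d_J = |k₀ + J•K|²/|K|²` of a coset ladder satisfies the hypotheses of `ladderFunctional_decay_intWindow`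
(`d₀ ≤ 1`, `d_J ≥ ½` for `J ≠ 0`, `d_{±1} ≤ 2`) as soon as `4|k₀| ≤ |K|` (`ladder_diag_bounds`) — in the low sectors of the crux,
`|ℓ′|/(n|m_j|) ≤ √c_W/K` is as small as the regime constant `K` makes it (recipe H2 of the S1D FAR assembly).
-/

set_option linter.dupNamespace false

noncomputable section

namespace Summit.AnomalousDissipation.AnomalousDissipation.Theorems.SolenoidalFractalHomogenisation.RealisedQuasiStaticCellLaw

open Literature.Analysis Literature.Analysis.FunctionSpaces Literature.Analysis.FunctionSpaces.Torus

/-- `latticeVec` is compatible with integer scalar multiplication. -/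
theorem latticeVec_zsmul (J : ℤ) (K : Fin 3 → ℤ) : latticeVec (J • K) = (J : ℝ) • latticeVec K := by
  ext i
  simp [latticeVec_apply]

/-- The norm of a coset frequency: `‖latticeVec (k₀ + J•K)‖ = ‖latticeVec k₀ + J • latticeVec K‖`. -/
theorem latticeVec_coset (k0 K : Fin 3 → ℤ) (J : ℤ) :
    latticeVec (k0 + J • K) = latticeVec k0 + (J : ℝ) • latticeVec K := by
  rw [latticeVec_add, latticeVec_zsmul]

/-- **The diagonal hypotheses of the ladder functional on a principal coset.** If `K ≠ 0` and `4‖k₀‖ ≤ ‖K‖` then, with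
`d_J = |k₀ + J•K|²/|K|²`: `d₀ ≤ 1`, `d_J ≥ ½` for `J ≠ 0`, `d₁ ≤ 2`, `d₋₁ ≤ 2`. -/
theorem ladder_diag_bounds {k0 K : Fin 3 → ℤ} (hK : K ≠ 0) (h : 4 * ‖latticeVec k0‖ ≤ ‖latticeVec K‖) :
    freqNormSq k0 / freqNormSq K ≤ 1 ∧
      (∀ J : ℤ, J ≠ 0 → 1 / 2 ≤ freqNormSq (k0 + J • K) / freqNormSq K) ∧
      freqNormSq (k0 + (1 : ℤ) • K) / freqNormSq K ≤ 2 ∧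
      freqNormSq (k0 + (-1 : ℤ) • K) / freqNormSq K ≤ 2 := by
  set a : ℝ := ‖latticeVec k0‖ with ha
  set b : ℝ := ‖latticeVec K‖ with hb
  have hb1 : 1 ≤ b := one_le_norm_latticeVec hK
  have hb0 : 0 < b := by linarith
  have ha0 : 0 ≤ a := norm_nonneg _
  have hKsq : freqNormSq K = b ^ 2 := by rw [← norm_latticeVec_sq]
  have hKpos : 0 < freqNormSq K := by rw [hKsq]; positivity
  have hk0sq : freqNormSq k0 = a ^ 2 := by rw [← norm_latticeVec_sq]
  have hJ : ∀ J : ℤ, freqNormSq (k0 + J • K) = ‖latticeVec k0 + (J : ℝ) • latticeVec K‖ ^ 2 := by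
    intro J; rw [← norm_latticeVec_sq, latticeVec_coset]
  refine ⟨?_, ?_, ?_, ?_⟩
  · rw [div_le_one hKpos, hk0sq, hKsq]
    nlinarith
  · intro J hJ0
    rw [le_div_iff₀ hKpos, hJ J, hKsq]
    have hJ1 : (1 : ℝ) ≤ |(J : ℝ)| := by
      rw [← Int.cast_abs]; exact_mod_cast Int.one_le_abs hJ0
    -- `‖k₀ + J K‖ ≥ |J| b - a ≥ 3b/4`
    have hlow : |(J : ℝ)| * b - a ≤ ‖latticeVec k0 + (J : ℝ) • latticeVec K‖ := by
      have h1 := norm_sub_norm_le ((J : ℝ) • latticeVec K) (-latticeVec k0)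
      rw [norm_smul, Real.norm_eq_abs, norm_neg, sub_neg_eq_add, add_comm] at h1
      linarith
    have h34 : 3 * b / 4 ≤ |(J : ℝ)| * b - a := by nlinarith
    have hpos : 0 ≤ 3 * b / 4 := by positivity
    nlinarith [mul_self_le_mul_self hpos (h34.trans hlow)]
  · rw [div_le_iff₀ hKpos, hJ 1, hKsq]
    have hup : ‖latticeVec k0 + ((1 : ℤ) : ℝ) • latticeVec K‖ ≤ a + b := by
      refine (norm_add_le _ _).trans ?_
      rw [norm_smul]; simp [ha, hb]
    have h54 : a + b ≤ 5 * b / 4 := by linarith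
    nlinarith [mul_self_le_mul_self (norm_nonneg _) (hup.trans h54), norm_nonneg (latticeVec k0 + ((1 : ℤ) : ℝ) • latticeVec K)]
  · rw [div_le_iff₀ hKpos, hJ (-1), hKsq]
    have hup : ‖latticeVec k0 + ((-1 : ℤ) : ℝ) • latticeVec K‖ ≤ a + b := by
      refine (norm_add_le _ _).trans ?_
      rw [norm_smul]; simp [ha, hb]
    have h54 : a + b ≤ 5 * b / 4 := by linarith
    nlinarith [mul_self_le_mul_self (norm_nonneg _) (hup.trans h54), norm_nonneg (latticeVec k0 + ((-1 : ℤ) : ℝ) • latticeVec K)]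

end Summit.AnomalousDissipation.AnomalousDissipation.Theorems.SolenoidalFractalHomogenisation.RealisedQuasiStaticCellLaw

end
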